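import Summits.QuantumFields.GaugeBoot.PeriodicLoopEquation
import Summits.QuantumFields.GaugeBoot.EquipartitionSOS
import HarnessLib

/-!
# Gauge-boot: the plaquette–gradient algebra and its SOS certificate on ANY periodic lattice `(A, e)` — the infinite
# lattice `ℤ^d` included (large-`N` supplement 19, part 1)

HONEST FRAMING (cell `pub-gaugeboot`, page 1 of every file): certified bounds on lattice
expectations at STATED coupling, gauge group, dimension and torus size; NOT a mass gap, NOT a
continuum limit, NOT a string tension, NOT large `N`; NOT Yang–Mills-summit-bearing (barriers
`FixedCouplingUltralocality`, `PerturbativeInvisibility`).  Pointwise matrix algebra and word-degree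
bookkeeping over the periodic word calculus of `PeriodicWords.lean`; it certifies no number.

## Content

Supplement 18 (`PlaquetteGradientIdentity`, `EquipartitionSOS`) derived the equipartition bound
`⟨ū_P⟩ ≤ 1 − c/(4(d−1)β + c)` on the cubic TORUS.  The algebra behind it only uses the word calculus, so it
holds verbatim on every periodic lattice `(A, e)` of `TiltedLatticeGauge.lean` — `A` any additive commutative
group of sites with marked translations `e : Fin d → A`; the infinite lattice `(ℤ^d, zdUnit)` of
`ZdPlaquetteInsertion.lean` and the 45°-tilted boxes are instances.  With `V_{ν,ε} = ρ(hol_x P̃_{ν,ε})` the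
holonomies of the `2(d−1)` plaquette words through the link `(x, μ)` re-oriented to start with it,
`M = Σ V` (`plaqSum`), `A = M − Mᴴ`:

* `sum_splitTerm_plaqWord` — only the first letter of `P̃_{ν,ε}` traverses `(x, μ)` (hypothesis `e ν ≠ 0`, the
  periodic form of `L ≥ 2`): the split terms of the periodic loop equation sum to `(N − s/N)·tr V_{ν,ε}`;
* ★★ `sum_plaqTerm_eq`, `sum_sum_plaqTerm_eq` — the plaquette terms summed over the plaquettes through the
  link: `tr(VM) − tr(VMᴴ) − (s/N)·tr V·(tr M − conj tr M)`, and the double sum `tr M² − tr MMᴴ − (s/N)T(T − T̄)`;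
* ★★ `sos_identity` — `16(d−1)·Σ_p (N − Re tr V_p) − ‖A‖² = 2(d−1)·Σ_p‖(1 − V_p) + (1 − V_p)ᴴ‖² +
  2(d−1)·Σ_p‖(V_p − V_pᴴ) − A/(2(d−1))‖²` (`d ≥ 2`, unitary `ρ`);
* `entriesIn_wordHolonomy`, `entriesIn_plaqWord`, `entriesIn_plaqSum` — the matrices of the certificate have
  entries which are word functions of degree `4` in the link variables of `(A, e)` (`WordSpaces`, `ι = Link A d`);
* `wordHolonomy_plaqWord_false`, `re_trace_plaqWord_false` — the `−`-oriented word through `(y + e_ν, μ)` carries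
  the plaquette at `y`: `Re tr ρ(hol_{y+e_ν} P̃_{ν,−}) = Re tr ρ(U_{y;μν})`.
[folklore] (equipartition / virial identity for the Wilson action; M. Creutz, *Quarks, gluons and lattices*
(1983) Ch. 11; S. Chatterjee, arXiv:1502.07719 §3.)
-/

noncomputable section

open scoped Matrix.Norms.Frobenius Matrix
open Literature.MathematicalPhysics.QuantumFieldTheory

namespace Summit.QuantumFields.GaugeBoot

namespace TiltedRP

namespace Equipartition

variable {A : Type} [AddCommGroup A] {d N : ℕ} {G : Type} [Group G]
  {ρ : G →* Matrix (Fin N) (Fin N) ℂ} (e : Fin d → A)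

/-! ## Split terms of the plaquette words through a link -/

section Split

variable [DecidableEq A]

variable (ρ) in
/-- **Split terms of the re-oriented plaquette words** `P̃_{ν,ε}` (`ν ≠ μ`, `e ν ≠ 0`) for the link `(x, μ)` of the
periodic lattice `(A, e)`: only the first letter traverses the link, contributing `(N − s/N)·tr ρ(hol P̃)`.
[folklore] -/
theorem sum_splitTerm_plaqWord {ν : Fin d} (hν : e ν ≠ 0) (s : ℂ) (x : A) {μ : Fin d} (hμν : μ ≠ ν)
    (U : Config A d G) (ε : Bool) :
    ∑ k ∈ Finset.range (plaqWord μ ν ε).length, splitTerm ρ e s x μ U (plaqWord μ ν ε) k =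
      ((N : ℂ) - s / N) * (ρ (wordHolonomy e U x (plaqWord μ ν ε))).trace := by
  have hlen : (plaqWord μ ν ε).length = 4 := by cases ε <;> rfl
  rw [hlen]
  simp only [Finset.sum_range_succ, Finset.sum_range_zero, zero_add]
  have h0 : splitTerm ρ e s x μ U (plaqWord μ ν ε) 0 =
      ((N : ℂ) - s / N) * (ρ (wordHolonomy e U x (plaqWord μ ν ε))).trace := by
    cases ε with
    | true =>
      unfold splitTerm
      simp only [plaqWord_true, Word.plaquette, List.getElem?_cons_zero, Word.siteAt_zero, Step.link_fwd, if_true,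
        Step.isFwd_fwd, List.take_zero, wordHolonomy_nil, map_one, Matrix.trace_one, Fintype.card_fin, List.drop_zero]
      ring
    | false =>
      unfold splitTerm
      simp only [plaqWord_false, List.getElem?_cons_zero, Word.siteAt_zero, Step.link_fwd, if_true, Step.isFwd_fwd,
        List.take_zero, wordHolonomy_nil, map_one, Matrix.trace_one, Fintype.card_fin, List.drop_zero]
      ring
  have h1x : x + e ν ≠ x := fun h => hν (by simpa using h)
  have h2x : x - e ν ≠ x := fun h => hν (by simpa using h)
  have h1 : splitTerm ρ e s x μ U (plaqWord μ ν ε) 1 = 0 := by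
    cases ε with
    | true => unfold splitTerm; simp [Word.plaquette, Word.siteAt, Word.endpoint, hμν.symm]
    | false => unfold splitTerm; simp [Word.siteAt, Word.endpoint, hμν.symm]
  have h2 : splitTerm ρ e s x μ U (plaqWord μ ν ε) 2 = 0 := by
    cases ε with
    | true =>
      unfold splitTerm
      have ex : x + e μ + e ν - e μ = x + e ν := by abel
      simp [Word.plaquette, Word.siteAt, Word.endpoint, ex, h1x]
    | false =>
      unfold splitTerm
      have ex : x + e μ - e ν - e μ = x - e ν := by abel
      simp [Word.siteAt, Word.endpoint, ex, h2x]
  have h3 : splitTerm ρ e s x μ U (plaqWord μ ν ε) 3 = 0 := by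
    cases ε with
    | true => unfold splitTerm; simp [Word.plaquette, Word.siteAt, Word.endpoint, hμν.symm]
    | false => unfold splitTerm; simp [Word.siteAt, Word.endpoint, hμν.symm]
  rw [h0, h1, h2, h3]
  ring

end Split

/-! ## The plaquette sum through a link and the summed plaquette terms in closed form -/

section Algebra

variable (ρ) in
/-- The sum `M = Σ_{ν≠μ,ε} ρ(hol P̃_{ν,ε})` of the holonomy matrices of the `2(d−1)` re-oriented plaquette words
through the link `(x, μ)` of `(A, e)`. [folklore] -/
def plaqSum (x : A) (μ : Fin d) (U : Config A d G) : Matrix (Fin N) (Fin N) ℂ :=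
  ∑ ν ∈ Finset.univ.erase μ, ∑ ε : Bool, ρ (wordHolonomy e U x (plaqWord μ ν ε))

/-- `plaqSum` as a sum over the product index set. [folklore] -/
theorem plaqSum_eq_sum_product (x : A) (μ : Fin d) (U : Config A d G) :
    plaqSum ρ e x μ U = ∑ p ∈ (Finset.univ.erase μ) ×ˢ (Finset.univ : Finset Bool),
      ρ (wordHolonomy e U x (plaqWord μ p.1 p.2)) := by
  rw [plaqSum, Finset.sum_product]

/-- ★★ **The plaquette terms of a closed marked word, summed over the plaquettes through the link, in closed
form**: `Σ_{ν'≠μ,ε'} plaqTerm_{ν',ε'}(w) = tr(V·M) − tr(V·Mᴴ) − (s/N)·tr V·(tr M − conj tr M)` with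
`V = ρ(hol w)`, `M = plaqSum` (unitary `ρ`). [folklore] -/
theorem sum_plaqTerm_eq (hρ : ∀ g, ρ g ∈ Matrix.unitaryGroup (Fin N) ℂ) (s : ℂ) (x : A) (μ : Fin d)
    (U : Config A d G) (w : Word d) (hw : Word.endpoint e x w = x) :
    ∑ ν' ∈ Finset.univ.erase μ, ∑ ε' : Bool, plaqTerm ρ e s x μ U w ν' ε' =
      (ρ (wordHolonomy e U x w) * plaqSum ρ e x μ U).trace -
        (ρ (wordHolonomy e U x w) * (plaqSum ρ e x μ U)ᴴ).trace -
        (s / N) * ((ρ (wordHolonomy e U x w)).trace *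
          ((plaqSum ρ e x μ U).trace - star (plaqSum ρ e x μ U).trace)) := by
  have happ : ∀ ν' ε', ρ (wordHolonomy e U x (w ++ plaqWord μ ν' ε')) =
      ρ (wordHolonomy e U x w) * ρ (wordHolonomy e U x (plaqWord μ ν' ε')) := fun ν' ε' => by
    rw [wordHolonomy_append_closed e U x w _ hw, map_mul]
  have hrev1 : ∀ ν' ε', ρ (wordHolonomy e U x (plaqWord μ ν' ε').reverse) =
      (ρ (wordHolonomy e U x (plaqWord μ ν' ε')))ᴴ := fun ν' ε' =>
    rho_wordHolonomy_reverse e hρ U x _ (endpoint_plaqWord e x μ ν' ε')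
  have hrev : ∀ ν' ε', ρ (wordHolonomy e U x (w ++ (plaqWord μ ν' ε').reverse)) =
      ρ (wordHolonomy e U x w) * (ρ (wordHolonomy e U x (plaqWord μ ν' ε')))ᴴ := fun ν' ε' => by
    rw [wordHolonomy_append_closed e U x w _ hw, map_mul, hrev1]
  have hts : ∀ B : Matrix (Fin N) (Fin N) ℂ, (Bᴴ).trace = star B.trace := fun B => Matrix.trace_conjTranspose B
  simp only [plaqTerm, happ, hrev, hrev1, hts, plaqSum, Finset.mul_sum, Matrix.trace_sum, Matrix.conjTranspose_sum,
    star_sum, Finset.sum_sub_distrib, mul_sub]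

/-- **The double plaquette sum in closed form**: summing also over the marked plaquette word,
`Σ_{ν,ε} Σ_{ν',ε'} plaqTerm_{ν',ε'}(P̃_{ν,ε}) = tr(M²) − tr(M Mᴴ) − (s/N)·tr M·(tr M − conj tr M)`. [folklore] -/
theorem sum_sum_plaqTerm_eq (hρ : ∀ g, ρ g ∈ Matrix.unitaryGroup (Fin N) ℂ) (s : ℂ) (x : A) (μ : Fin d)
    (U : Config A d G) :
    ∑ ν ∈ Finset.univ.erase μ, ∑ ε : Bool, ∑ ν' ∈ Finset.univ.erase μ, ∑ ε' : Bool,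
        plaqTerm ρ e s x μ U (plaqWord μ ν ε) ν' ε' =
      (plaqSum ρ e x μ U * plaqSum ρ e x μ U).trace - (plaqSum ρ e x μ U * (plaqSum ρ e x μ U)ᴴ).trace -
        (s / N) * ((plaqSum ρ e x μ U).trace * ((plaqSum ρ e x μ U).trace - star (plaqSum ρ e x μ U).trace)) := by
  simp only [sum_plaqTerm_eq e hρ s x μ U _ (endpoint_plaqWord e x μ _ _)]
  set M := plaqSum ρ e x μ U with hM
  have hsum : ∑ ν ∈ Finset.univ.erase μ, ∑ ε : Bool, ρ (wordHolonomy e U x (plaqWord μ ν ε)) = M := rfl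
  simp only [Finset.sum_sub_distrib, ← Matrix.trace_sum, ← Finset.sum_mul, hsum, ← Finset.mul_sum]

/-! ## The sum-of-squares identity -/

/-- ★★ **THE SOS IDENTITY on `(A, e)`.**  With `V_p = ρ(hol P̃_p)` (`p = (ν, ε)`), `B_p = V_p − V_pᴴ`,
`A = Σ_p B_p = M − Mᴴ`, `n = 2(d−1)`, for unitary `ρ` and `d ≥ 2`:
`16(d−1)·Σ_p (N − Re tr V_p) − ‖A‖² = 2(d−1)·Σ_p ‖(1 − V_p) + (1 − V_p)ᴴ‖² + 2(d−1)·Σ_p ‖B_p − A/(2(d−1))‖²`.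
[folklore] -/
theorem sos_identity (hρ : ∀ g, ρ g ∈ Matrix.unitaryGroup (Fin N) ℂ) (hd : 2 ≤ d) (x : A) (μ : Fin d)
    (U : Config A d G) :
    16 * ((d : ℝ) - 1) * (∑ p ∈ (Finset.univ.erase μ) ×ˢ (Finset.univ : Finset Bool),
        ((N : ℝ) - (ρ (wordHolonomy e U x (plaqWord μ p.1 p.2))).trace.re)) -
      ‖plaqSum ρ e x μ U - (plaqSum ρ e x μ U)ᴴ‖ ^ 2 =
    2 * ((d : ℝ) - 1) * (∑ p ∈ (Finset.univ.erase μ) ×ˢ (Finset.univ : Finset Bool),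
        ‖((1 : Matrix (Fin N) (Fin N) ℂ) - ρ (wordHolonomy e U x (plaqWord μ p.1 p.2))) +
          ((1 : Matrix (Fin N) (Fin N) ℂ) - ρ (wordHolonomy e U x (plaqWord μ p.1 p.2)))ᴴ‖ ^ 2) +
    2 * ((d : ℝ) - 1) * (∑ p ∈ (Finset.univ.erase μ) ×ˢ (Finset.univ : Finset Bool),
        ‖(ρ (wordHolonomy e U x (plaqWord μ p.1 p.2)) - (ρ (wordHolonomy e U x (plaqWord μ p.1 p.2)))ᴴ) -
          (((2 * ((d : ℝ) - 1))⁻¹ : ℝ) : ℂ) • (plaqSum ρ e x μ U - (plaqSum ρ e x μ U)ᴴ)‖ ^ 2) := by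
  set S := (Finset.univ.erase μ) ×ˢ (Finset.univ : Finset Bool) with hS
  have hcard : (S.card : ℝ) = 2 * ((d : ℝ) - 1) := Summit.QuantumFields.GaugeBoot.Equipartition.card_plaqIndex μ
  have hne : S.Nonempty := by
    obtain ⟨ν, hν⟩ : ∃ ν : Fin d, ν ≠ μ := by
      by_cases h0 : μ = ⟨0, by omega⟩
      · exact ⟨⟨1, by omega⟩, fun h => by rw [h0] at h; exact absurd (congrArg Fin.val h) (by norm_num)⟩
      · exact ⟨⟨0, by omega⟩, fun h => h0 h.symm⟩
    exact ⟨(ν, true), Finset.mem_product.2 ⟨Finset.mem_erase.2 ⟨hν, Finset.mem_univ _⟩, Finset.mem_univ _⟩⟩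
  -- `A = Σ B`
  have hA : plaqSum ρ e x μ U - (plaqSum ρ e x μ U)ᴴ =
      ∑ p ∈ S, (ρ (wordHolonomy e U x (plaqWord μ p.1 p.2)) - (ρ (wordHolonomy e U x (plaqWord μ p.1 p.2)))ᴴ) := by
    rw [plaqSum_eq_sum_product, Matrix.conjTranspose_sum, ← Finset.sum_sub_distrib]
  -- per plaquette: `16 (N − Re tr V) = 2‖P + Pᴴ‖² + 2‖B‖²`, `P = 1 − V`, `P − Pᴴ = −B`
  have hcost : ∀ p : Fin d × Bool, 16 * ((N : ℝ) - (ρ (wordHolonomy e U x (plaqWord μ p.1 p.2))).trace.re) =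
      2 * ‖((1 : Matrix (Fin N) (Fin N) ℂ) - ρ (wordHolonomy e U x (plaqWord μ p.1 p.2))) +
          ((1 : Matrix (Fin N) (Fin N) ℂ) - ρ (wordHolonomy e U x (plaqWord μ p.1 p.2)))ᴴ‖ ^ 2 +
        2 * ‖ρ (wordHolonomy e U x (plaqWord μ p.1 p.2)) - (ρ (wordHolonomy e U x (plaqWord μ p.1 p.2)))ᴴ‖ ^ 2 := by
    intro p
    set V := ρ (wordHolonomy e U x (plaqWord μ p.1 p.2)) with hV
    have h1 := UnitaryCayley.re_trace_one_sub (hρ (wordHolonomy e U x (plaqWord μ p.1 p.2)))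
    rw [← hV, Matrix.trace_sub, Matrix.trace_one, Complex.sub_re, Fintype.card_fin, Complex.natCast_re] at h1
    have h2 := Summit.QuantumFields.GaugeBoot.Equipartition.norm_sq_add_conjTranspose_add
      ((1 : Matrix (Fin N) (Fin N) ℂ) - V)
    have h3 : ((1 : Matrix (Fin N) (Fin N) ℂ) - V) - ((1 : Matrix (Fin N) (Fin N) ℂ) - V)ᴴ = -(V - Vᴴ) := by
      rw [Matrix.conjTranspose_sub, Matrix.conjTranspose_one]; abel
    rw [h3, norm_neg] at h2
    have h1' : (N : ℝ) - V.trace.re = ‖(1 : Matrix (Fin N) (Fin N) ℂ) - V‖ ^ 2 / 2 := h1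
    rw [h1']
    linarith
  have hvar := Summit.QuantumFields.GaugeBoot.Equipartition.card_mul_sum_norm_sub_avg_sq S hne
    (fun p => ρ (wordHolonomy e U x (plaqWord μ p.1 p.2)) - (ρ (wordHolonomy e U x (plaqWord μ p.1 p.2)))ᴴ)
  beta_reduce at hvar
  rw [hcard] at hvar
  rw [hA]
  have hsum16 : 16 * ((d : ℝ) - 1) * ∑ p ∈ S, ((N : ℝ) - (ρ (wordHolonomy e U x (plaqWord μ p.1 p.2))).trace.re) =
      ((d : ℝ) - 1) * ∑ p ∈ S, 16 * ((N : ℝ) - (ρ (wordHolonomy e U x (plaqWord μ p.1 p.2))).trace.re) := by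
    rw [Finset.mul_sum, Finset.mul_sum]
    exact Finset.sum_congr rfl fun p _ => by ring
  rw [hsum16]
  simp only [hcost, Finset.sum_add_distrib, ← Finset.mul_sum]
  linarith [hvar]

end Algebra

/-! ## The `−`-oriented plaquette word carries a lattice plaquette -/

section Orientation

/-- The `−`-oriented word through `(y + e_ν, μ)` is a conjugate of the INVERSE of the plaquette at `y`:
`hol_{y+e_ν}(+μ −ν −μ +ν) = U(y,ν)⁻¹ · U_{y;μν}⁻¹ · U(y,ν)`. [folklore] -/
theorem wordHolonomy_plaqWord_false (U : Config A d G) (y : A) (μ ν : Fin d) :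
    wordHolonomy e U (y + e ν) (plaqWord μ ν false) = (U (y, ν))⁻¹ * (holonomy e U y μ ν)⁻¹ * U (y, ν) := by
  have h1 : y + e ν + e μ - e ν = y + e μ := by abel
  have h2 : y + e μ - e μ = y := by abel
  simp only [plaqWord_false, wordHolonomy_cons, wordHolonomy_nil, stepHolonomy_fwd, stepHolonomy_bwd, Step.move_fwd,
    Step.move_bwd, h1, h2, holonomy, mul_inv_rev, inv_inv, mul_one, mul_assoc, inv_mul_cancel_left]

/-- `Re tr ρ(hol_{y+e_ν} P̃_{ν,−}) = Re tr ρ(U_{y;μν})` (unitary `ρ`: the trace is a class function and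
`Re tr ρ(g⁻¹) = Re tr ρ(g)`). [folklore] -/
theorem re_trace_plaqWord_false (hρ : ∀ g, ρ g ∈ Matrix.unitaryGroup (Fin N) ℂ) (U : Config A d G) (y : A)
    (μ ν : Fin d) :
    (ρ (wordHolonomy e U (y + e ν) (plaqWord μ ν false))).trace.re = (ρ (holonomy e U y μ ν)).trace.re := by
  have hinv : ρ (holonomy e U y μ ν)⁻¹ = (ρ (holonomy e U y μ ν))ᴴ :=
    Literature.MathematicalPhysics.QuantumLattice.unitaryRep_inv_eq_conjTranspose ρ hρ _
  rw [wordHolonomy_plaqWord_false, map_mul, map_mul, Matrix.trace_mul_cycle, ← map_mul, mul_inv_cancel, map_one,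
    Matrix.one_mul, hinv, Matrix.trace_conjTranspose, Complex.star_def, Complex.conj_re]

/-- `Re tr ρ(hol_x P̃_{ν,+}) = Re tr ρ(U_{x;μν})`. [folklore] -/
theorem re_trace_plaqWord_true (U : Config A d G) (x : A) (μ ν : Fin d) :
    (ρ (wordHolonomy e U x (plaqWord μ ν true))).trace.re = (ρ (holonomy e U x μ ν)).trace.re := by
  rw [plaqWord_true, wordHolonomy_plaquette]

end Orientation

end Equipartition

/-! ## Word-degree bookkeeping on `(A, e)`: the certificate's matrices have level-4 entries -/

section Entries

variable {A : Type} [AddCommGroup A] {d : ℕ} {G : Type} [Group G] [TopologicalSpace G] (r : LatticeRep G)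
  (e : Fin d → A)

omit [AddCommGroup A] in
/-- The identity matrix has entries in every word space (constants). [folklore] -/
theorem entriesIn_one (S : Set (Link A d)) (n : ℕ) :
    EntriesIn r S n (fun _ : Config A d G => (1 : Matrix (Fin r.N) (Fin r.N) ℂ)) := by
  intro a b
  by_cases h : a = b
  · subst h
    refine ⟨?_, ?_⟩
    · have e1 : (fun _ : Config A d G => ((1 : Matrix (Fin r.N) (Fin r.N) ℂ) a a).re) = fun _ => (1 : ℝ) := by
        funext U; simp
      rw [e1]; exact const_mem_wordFunctions r S n 1
    · have e1 : (fun _ : Config A d G => ((1 : Matrix (Fin r.N) (Fin r.N) ℂ) a a).im) = fun _ => (0 : ℝ) := by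
        funext U; simp
      rw [e1]; exact const_mem_wordFunctions r S n 0
  · refine ⟨?_, ?_⟩
    · have e1 : (fun _ : Config A d G => ((1 : Matrix (Fin r.N) (Fin r.N) ℂ) a b).re) = fun _ => (0 : ℝ) := by
        funext U; simp [Matrix.one_apply_ne h]
      rw [e1]; exact const_mem_wordFunctions r S n 0
    · have e1 : (fun _ : Config A d G => ((1 : Matrix (Fin r.N) (Fin r.N) ℂ) a b).im) = fun _ => (0 : ℝ) := by
        funext U; simp [Matrix.one_apply_ne h]
      rw [e1]; exact const_mem_wordFunctions r S n 0

/-- A step holonomy has entries in degree `1` (`U_l` forward, `U_l⁻¹ = U_lᴴ` backward). [folklore] -/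
theorem entriesIn_stepHolonomy (x : A) (s : Step d) :
    EntriesIn r (Set.univ : Set (Link A d)) 1 (fun U : Config A d G => r.ρ (stepHolonomy e U x s)) := by
  cases s with
  | fwd μ => exact entriesIn_rho r (Set.mem_univ (x, μ)) le_rfl
  | bwd μ => exact entriesIn_rho_inv r (Set.mem_univ (x - e μ, μ)) le_rfl

/-- ★ **The entries of `ρ(hol_x(w))` are word functions of degree `|w|`** (periodic lattice). [folklore] -/
theorem entriesIn_wordHolonomy : ∀ (x : A) (w : Word d),
    EntriesIn r (Set.univ : Set (Link A d)) w.length (fun U : Config A d G => r.ρ (wordHolonomy e U x w))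
  | x, [] => by
    simpa only [wordHolonomy_nil, map_one, List.length_nil] using entriesIn_one r (Set.univ : Set (Link A d)) 0
  | x, s :: w => by
    have h := (entriesIn_stepHolonomy r e x s).mul r (entriesIn_wordHolonomy (s.move e x) w)
    rw [Nat.add_comm] at h
    simpa only [wordHolonomy_cons, map_mul, List.length_cons] using h

/-- ★ The plaquette holonomies through a link have level-4 entries. [folklore] -/
theorem entriesIn_plaqWord (x : A) (μ ν : Fin d) (ε : Bool) :
    EntriesIn r (Set.univ : Set (Link A d)) 4 (fun U : Config A d G => r.ρ (wordHolonomy e U x (plaqWord μ ν ε))) := by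
  have h := entriesIn_wordHolonomy r e x (plaqWord μ ν ε)
  rwa [length_plaqWord] at h

/-- `plaqSum` has level-4 entries. [folklore] -/
theorem entriesIn_plaqSum (x : A) (μ : Fin d) :
    EntriesIn r (Set.univ : Set (Link A d)) 4 (fun U : Config A d G => Equipartition.plaqSum r.ρ e x μ U) := by
  unfold Equipartition.plaqSum
  exact EntriesIn.sum r _ fun ν => EntriesIn.sum r _ fun ε => entriesIn_plaqWord r e x μ ν ε

end Entries

end TiltedRP

end Summit.QuantumFields.GaugeBoot

end
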